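import Literature.NumberTheory.LFunctions.RealPointExitsUnderGRH
import HarnessLib

/-!
# The Hecke point of the one-point exits, sharp algebra: `L(1 − 1/log(√d/2), χ) ≥ 0 ⇒ h_K ≥ √d/(e log d) − 2.75`;
# `GRH ⇒ h_K ≥ √d/(e log d) − 2.75`; `h_K < √d/(e log d) − 2.75 ⇒` a real zero in `(1 − 1/log(√d/2), 1)`

Topic `Literature/NumberTheory/LFunctions` (namespace `Literature.NumberTheory.LFunctions`, sub-namespace
`RealPointExit`). Everything here is PROVED (theorems only; no definition, no named fact, debt 0). Cell
`parity-realchar` (SIEGEL INSTRUMENT, conditionals column (3)): the Hecke point of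
`RealPointNonnegativityClassNumberBound.lean` / `RealPointExitsUnderGRH.lean` redone with EXACT algebra in place of
the crude `1/3`, `2/3`, `3/4` factors, doubling the constant: `√d/(2e log d) − 5` becomes `√d/(e log d) − 2.75`.

At `σ = 1 − 1/L`, `L = log y`, `y = √d/2`: `y^σ = y/e`, `y^{1−σ} = e`, and
`σ(1−σ)·2(y/e)(L/(L−2) − L/(2L−2)) = (y/e)/(L−2)` EXACTLY, while
`σ(1−σ)(2e(L/2 + L/(L−2)) + 1) = e(L−1)/L + 2e(L−1)/(L(L−2)) + (L−1)/L² ≤ e + 7e/24 + 7/64 < 3.63` for `L ≥ 8`.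
Hence (`heckePoint_bound_sharp`) the one-point bound at the Hecke point is `≥ (y/e)/(log y − 2) − 2.63`, and
`(y/e)/(log y − 2) ≥ √d/(e log d)` (`log(√d/2) − 2 < ½ log d`):

* `classNumber_ge_of_LFunction_heckePoint_nonneg_sharp` — **`0 ≤ Re L(1 − 1/log(√d/2), χ)` ⇒
  `h_K ≥ (√d/2)/(e(log(√d/2) − 2)) − 2.75 ≥ √d/(e log d) − 2.75`** (`√d/2 ≥ e⁸`);
* `exists_realZero_near_one_of_classNumber_lt_sharp` — **`h_K < √d/(e log d) − 2.75` ⇒ a real zero of `L(s, χ)`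
  in `(1 − 1/log(√d/2), 1)`**;
* `classNumber_ge_of_GRH_heckePoint_sharp` — **GRH ⇒ `h_K ≥ √d/(e log d) − 2.75`** (`√d/2 ≥ e⁸`, i.e.
  `d ≥ 4e¹⁶ ≈ 3.6·10⁷`; the tree's kernel Hecke lemma under GRH gives `√d/(8π log d)`, `9×` smaller; print's GRH order
  is `√d/log log d`, not claimed).

LABEL (cell rule): conditionals II one-point family (Hecke point, sharp constant), kernel. WHAT THIS IS NOT: no new
mechanism; nothing here bears on parity (H5).
-/

noncomputable section

open Complex Filter Topology Set
open Literature.Barriers.Parity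
open Literature.NumberTheory.QuadraticFields Literature.NumberTheory.QuadraticFields.Quadratic
open _root_.NumberField Module

namespace Literature.NumberTheory.LFunctions

namespace RealPointExit

set_option maxHeartbeats 400000 in
/-- Sharp numerics at the Hecke point: for `L = log y ≥ 8` and `σ = 1 − 1/L`,
`1 + σ(1−σ)[2(y/e)(1/(2σ−1) − 1/(2σ)) − 2e(1/(2−2σ) + 1/(2σ−1)) − 1] ≥ (y/e)/(L − 2) − 2.63`
(the positive part is EXACTLY `(y/e)/(L−2)`). [folklore] -/
private theorem heckePoint_bound_sharp {y : ℝ} (hy : Real.exp 8 ≤ y) :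
    y / Real.exp 1 / (Real.log y - 2) - 2.63 ≤
      1 + (1 - 1 / Real.log y) * (1 - (1 - 1 / Real.log y)) *
        (2 * y ^ (1 - 1 / Real.log y) * (1 / (2 * (1 - 1 / Real.log y) - 1) - 1 / (2 * (1 - 1 / Real.log y))) -
          2 * y ^ (1 - (1 - 1 / Real.log y)) *
            (1 / (2 - 2 * (1 - 1 / Real.log y)) + 1 / (2 * (1 - 1 / Real.log y) - 1)) - 1) := by
  have he8 : 0 < Real.exp 8 := Real.exp_pos 8
  have hy0 : 0 < y := lt_of_lt_of_le he8 hy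
  set L := Real.log y with hLdef
  have hL8 : 8 ≤ L := by
    rw [hLdef, Real.le_log_iff_exp_le hy0]; exact hy
  have hL0 : 0 < L := by linarith
  -- `y^{1/L} = e`, `y^{1 − 1/L} = y/e`
  have hpow1 : y ^ (1 / L) = Real.exp 1 := by
    rw [Real.rpow_def_of_pos hy0, ← hLdef]
    congr 1
    field_simp
  have hpow2 : y ^ (1 - 1 / L) = y / Real.exp 1 := by
    rw [Real.rpow_sub hy0, Real.rpow_one, hpow1]
  have e1 : (1 : ℝ) - (1 - 1 / L) = 1 / L := by ring
  rw [e1, hpow1, hpow2]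
  set e := Real.exp 1 with hedef
  have he0 : 0 < e := Real.exp_pos 1
  have he : e < 2.7182818286 := Real.exp_one_lt_d9
  have he' : 2.7182818283 < e := Real.exp_one_gt_d9
  -- exact simplification of the σ-expressions
  have hL2 : 0 < L - 2 := by linarith
  have hL1 : 0 < L - 1 := by linarith
  have eσ1 : 2 * (1 - 1 / L) - 1 = (L - 2) / L := by field_simp; ring
  have eσ2 : 2 * (1 - 1 / L) = (2 * L - 2) / L := by field_simp
  have eσ3 : 2 - 2 * (1 - 1 / L) = 2 / L := by field_simp; ring
  rw [eσ1, eσ3, eσ2]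
  have r1 : 1 / ((L - 2) / L) = L / (L - 2) := by rw [one_div_div]
  have r2 : 1 / ((2 * L - 2) / L) = L / (2 * L - 2) := by rw [one_div_div]
  have r3 : 1 / (2 / L) = L / 2 := by rw [one_div_div]
  rw [r1, r2, r3]
  -- the positive part, exactly: `s · 2(y/e)(L/(L−2) − L/(2L−2)) = (y/e)/(L−2)`
  have hpos : (1 - 1 / L) * (1 / L) * (2 * (y / e) * (L / (L - 2) - L / (2 * L - 2))) =
      y / e / (L - 2) := by
    field_simp
    ring
  -- the negative part: `s · (2e(L/2 + L/(L−2)) + 1) ≤ e + 7e/24 + 7/64`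
  have hneg : (1 - 1 / L) * (1 / L) * (2 * e * (L / 2 + L / (L - 2)) + 1) ≤ e + 7 * e / 24 + 7 / 64 := by
    have h1 : (1 - 1 / L) * (1 / L) * (2 * e * (L / 2)) = e * (L - 1) / L := by field_simp
    have h2 : (1 - 1 / L) * (1 / L) * (2 * e * (L / (L - 2))) = 2 * e * ((L - 1) / (L * (L - 2))) := by
      field_simp
    have h3 : (1 - 1 / L) * (1 / L) * 1 = (L - 1) / L ^ 2 := by field_simp
    have hb1 : e * (L - 1) / L ≤ e := by
      rw [div_le_iff₀ hL0]; nlinarith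
    have hb2 : (L - 1) / (L * (L - 2)) ≤ 7 / 48 := by
      rw [div_le_div_iff₀ (by positivity) (by norm_num)]; nlinarith
    have hb3 : (L - 1) / L ^ 2 ≤ 7 / 64 := by
      rw [div_le_div_iff₀ (by positivity) (by norm_num)]; nlinarith
    have hsplit : (1 - 1 / L) * (1 / L) * (2 * e * (L / 2 + L / (L - 2)) + 1) =
        e * (L - 1) / L + 2 * e * ((L - 1) / (L * (L - 2))) + (L - 1) / L ^ 2 := by
      rw [← h1, ← h2, ← h3]; ring
    rw [hsplit]
    nlinarith
  have hnum : e + 7 * e / 24 + 7 / 64 < 3.63 := by nlinarith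
  -- assemble: `1 + s(A − B − 1) = 1 + sA − s(B + 1)`
  have hsplit2 : 1 + (1 - 1 / L) * (1 / L) *
      (2 * (y / e) * (L / (L - 2) - L / (2 * L - 2)) - 2 * e * (L / 2 + L / (L - 2)) - 1) =
      1 + (1 - 1 / L) * (1 / L) * (2 * (y / e) * (L / (L - 2) - L / (2 * L - 2))) -
        (1 - 1 / L) * (1 / L) * (2 * e * (L / 2 + L / (L - 2)) + 1) := by ring
  rw [hsplit2, hpos]
  linarith

variable {K : Type*} [Field K] [NumberField K]

/-- From `√d/2 ≥ e⁸`: basic facts. [folklore] -/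
private theorem basics {d : ℕ} (hd : Real.exp 8 ≤ Real.sqrt d / 2) :
    1 < Real.sqrt d / 2 ∧ 4 < d ∧ 8 ≤ Real.log (Real.sqrt d / 2) ∧ (0 : ℝ) < d := by
  have he8 : (1 : ℝ) < Real.exp 8 := by have := Real.add_one_le_exp (8 : ℝ); linarith
  have hy1 : 1 < Real.sqrt d / 2 := lt_of_lt_of_le he8 hd
  have hd4 : 4 < d := by
    by_contra hcon
    push Not at hcon
    have : Real.sqrt d ≤ Real.sqrt 4 := Real.sqrt_le_sqrt (by exact_mod_cast hcon)
    have h4 : Real.sqrt 4 = 2 := by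
      rw [show (4 : ℝ) = 2 ^ 2 by norm_num, Real.sqrt_sq (by norm_num)]
    linarith
  refine ⟨hy1, hd4, ?_, by exact_mod_cast (show 0 < d by omega)⟩
  rw [Real.le_log_iff_exp_le (by linarith)]; exact hd

/-- `(√d/2)/(e(log(√d/2) − 2)) ≥ √d/(e log d)` since `log(√d/2) − 2 < ½ log d`. [folklore] -/
private theorem hecke_main_ge {d : ℕ} (hd : Real.exp 8 ≤ Real.sqrt d / 2) :
    Real.sqrt d / (Real.exp 1 * Real.log d) ≤ Real.sqrt d / 2 / Real.exp 1 / (Real.log (Real.sqrt d / 2) - 2) := by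
  obtain ⟨hy1, hd4, hL8, hd0⟩ := basics hd
  have hsd0 : 0 < Real.sqrt d := Real.sqrt_pos.2 hd0
  have he0 : 0 < Real.exp 1 := Real.exp_pos 1
  have hlog : Real.log (Real.sqrt d / 2) = Real.log d / 2 - Real.log 2 := by
    rw [Real.log_div hsd0.ne' two_ne_zero, Real.log_sqrt hd0.le]
  have hl2 := Real.log_two_gt_d9
  have hL2 : 0 < Real.log (Real.sqrt d / 2) - 2 := by linarith
  have hlogd : 0 < Real.log d := by linarith
  have h2 : 2 * (Real.log (Real.sqrt d / 2) - 2) ≤ Real.log d := by rw [hlog]; linarith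
  rw [div_div, div_div]
  apply div_le_div_of_nonneg_left hsd0.le (by positivity)
  calc 2 * (Real.exp 1 * (Real.log (Real.sqrt d / 2) - 2))
      = Real.exp 1 * (2 * (Real.log (Real.sqrt d / 2) - 2)) := by ring
    _ ≤ Real.exp 1 * Real.log d := mul_le_mul_of_nonneg_left h2 he0.le

/-- **The Hecke point, sharp: `0 ≤ Re L(1 − 1/log(√d/2), χ)` ⇒
`h_K ≥ (√d/2)/(e(log(√d/2) − 2)) − 2.75 ≥ √d/(e log d) − 2.75`** (`√d/2 ≥ e⁸`; `χ` odd real primitive mod `d`,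
`K` quadratic with `d_K = −d`). [cite: MontgomeryVaughan2007, §11.2 Theorem 11.4] [cite: IwaniecConversations2006, §5] -/
theorem classNumber_ge_of_LFunction_heckePoint_nonneg_sharp (h2 : finrank ℚ K = 2) {d : ℕ} [NeZero d]
    (hdK : NumberField.discr K = -(d : ℤ)) (hd : Real.exp 8 ≤ Real.sqrt d / 2) {χ : DirichletCharacter ℂ d}
    (hprim : χ.IsPrimitive) (hquad : χ.IsQuadratic) (hodd : χ.Odd)
    (hL : 0 ≤ (χ.LFunction ((1 - 1 / Real.log (Real.sqrt d / 2) : ℝ) : ℂ)).re) :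
    Real.sqrt d / (Real.exp 1 * Real.log d) - 2.75 ≤ (classNumber K : ℝ) ∧
      Real.sqrt d / 2 / Real.exp 1 / (Real.log (Real.sqrt d / 2) - 2) - 2.75 ≤ (classNumber K : ℝ) := by
  obtain ⟨hy1, hd4, hL8, hd0⟩ := basics hd
  set y := Real.sqrt d / 2 with hydef
  set L := Real.log y with hLdef
  have hL0 : 0 < L := by linarith
  have hσ : 1 / 2 < 1 - 1 / L := by
    have : 1 / L ≤ 1 / 8 := one_div_le_one_div_of_le (by norm_num) hL8
    linarith
  have hσ1 : 1 - 1 / L < 1 := by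
    have : 0 < 1 / L := by positivity
    linarith
  have hmain := classNumber_ge_of_LFunction_ofReal_nonneg h2 hdK hd4 hprim hquad hodd hσ hσ1 hL
  have hnum := heckePoint_bound_sharp hd
  rw [← hLdef] at hnum
  rw [← hydef] at hmain
  have hge := hecke_main_ge hd
  rw [← hydef, ← hLdef] at hge
  constructor <;> linarith

/-- **`h_K < √d/(e log d) − 2.75` ⇒ `L(s, χ)` has a real zero in `(1 − 1/log(√d/2), 1)`** (`√d/2 ≥ e⁸`) — the
sharp form of `exists_realZero_near_one_of_classNumber_lt`. [cite: MontgomeryVaughan2007, §11.2 Theorem 11.4]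
[cite: IwaniecConversations2006, §5] -/
theorem exists_realZero_near_one_of_classNumber_lt_sharp (h2 : finrank ℚ K = 2) {d : ℕ} [NeZero d]
    (hdK : NumberField.discr K = -(d : ℤ)) (hd : Real.exp 8 ≤ Real.sqrt d / 2) {χ : DirichletCharacter ℂ d}
    (hprim : χ.IsPrimitive) (hquad : χ.IsQuadratic) (hodd : χ.Odd)
    (hh : (classNumber K : ℝ) < Real.sqrt d / (Real.exp 1 * Real.log d) - 2.75) :
    ∃ β : ℝ, 1 - 1 / Real.log (Real.sqrt d / 2) < β ∧ β < 1 ∧ χ.LFunction β = 0 := by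
  obtain ⟨hy1, hd4, hL8, hd0⟩ := basics hd
  set y := Real.sqrt d / 2 with hydef
  set L := Real.log y with hLdef
  have hL0 : 0 < L := by linarith
  have hσ : 1 / 2 < 1 - 1 / L := by
    have : 1 / L ≤ 1 / 8 := one_div_le_one_div_of_le (by norm_num) hL8
    linarith
  have hσ1 : 1 - 1 / L < 1 := by
    have : 0 < 1 / L := by positivity
    linarith
  refine (exists_realZero_of_classNumber_lt h2 hdK hd4 hprim hquad hodd hσ hσ1 ?_).2
  have hnum := heckePoint_bound_sharp hd
  rw [← hLdef] at hnum
  rw [← hydef]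
  have hge := hecke_main_ge hd
  rw [← hydef, ← hLdef] at hge
  linarith

/-- **GRH ⇒ `h_K ≥ √d/(e log d) − 2.75`** (`√d/2 ≥ e⁸`, i.e. `d ≥ 4e¹⁶`): the sharp Hecke point under the tree's
open-strip GRH (antecedent). [cite: MontgomeryVaughan2007, §11.2 Theorem 11.4] [cite: IwaniecConversations2006, §5] -/
theorem classNumber_ge_of_GRH_heckePoint_sharp (hGRH : GeneralizedRiemannHypothesis) (h2 : finrank ℚ K = 2)
    {d : ℕ} [NeZero d] (hdK : NumberField.discr K = -(d : ℤ)) (hd : Real.exp 8 ≤ Real.sqrt d / 2)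
    {χ : DirichletCharacter ℂ d} (hprim : χ.IsPrimitive) (hquad : χ.IsQuadratic) (hodd : χ.Odd) :
    Real.sqrt d / (Real.exp 1 * Real.log d) - 2.75 ≤ (classNumber K : ℝ) := by
  obtain ⟨hy1, hd4, hL8, hd0⟩ := basics hd
  have hσ : 1 / 2 < 1 - 1 / Real.log (Real.sqrt d / 2) := by
    have : 1 / Real.log (Real.sqrt d / 2) ≤ 1 / 8 := one_div_le_one_div_of_le (by norm_num) hL8
    linarith
  have hσ1 : 1 - 1 / Real.log (Real.sqrt d / 2) ≤ 1 := by
    have : 0 < 1 / Real.log (Real.sqrt d / 2) := by positivity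
    linarith
  have hχ1 : χ ≠ 1 := by
    intro h
    have h1 : χ (-1) = -1 := hodd
    rw [h, MulChar.one_apply (isUnit_one.neg)] at h1
    norm_num at h1
  exact (classNumber_ge_of_LFunction_heckePoint_nonneg_sharp h2 hdK hd hprim hquad hodd
    (LFunction_ofReal_re_pos_of_GRH hGRH hχ1 hquad hσ hσ1).le).1

end RealPointExit

end Literature.NumberTheory.LFunctions

end
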